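import Summits.ResolutionOfSingularities.ResolutionOfSingularities.Theorems.FrobeniusLadderFInjectiveMacaulayficationStepDoorStacksFree
import HarnessLib

/-!
# Q10 «FLATTENING-FREE DOOR TWIN», file C1: the per-dimension slice engine and ★ «dim ≤ 4 ⟸ TWO PRINTS ∧ F(4)» without Raynaud–Gruson
# (crux `FInjectiveMacaulayfication` stmt-ResolutionOfSingularities-15315, chain w45a; res-L1-w45a-plan-1 RULING R21.6 (2) «Q10»; INPUTS-CP-v12 ADDENDUM 6 §1; seat res-L1-w45a-lead-1 g10)

[OURS · L1 W4.5a] Support file (`--supports stmt-ResolutionOfSingularities-15315 --as helper`); def-free; ZERO new mathematics — §1 = FLATTENING-FREE TWINS (name = original ++ `F`; statement =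
original minus `(h081R : Stacks081R)`; proof = original text over the twins of files A/B `…ThreefoldOneBlowupFree` / `…StepDoorStacksFree`) of `DimSliceCM.fiModel_integral_dimLe_of_cm_of_rungs_of_F`,
`DimSliceCM.exists_fiModel_dimLe_of_cm_of_rungs_of_F`, `DimSliceCM.fInjectiveMacaulayfication_dimLe_of_cm_of_rungs_of_F`, `DimSliceOfCesnavicius.fInjectiveMacaulayfication_dimLe_of_cesnaviciusOffClosed_of_rungs_of_F`,
`DimSliceOfCesnavicius.fInjectiveMacaulayfication_dimLe4_of_cesnaviciusOffClosed_of_F4`; §2 ★★ `fInjectiveMacaulayfication_dimLe4_of_twoPrints_of_F4` — ON SCHEMES OF DIMENSION ≤ 4 the crux ⟸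
Cossart–Piltant 2019 Thm 1.1 ∧ Česnavičius 2021 Thm 5.3-(B) ∧ the F-half AT LEVEL 4 (CP 2019 Prop 4.4 by the tree theorem, Raynaud–Gruson re-plumbed; no resolution residue). Nothing of the
crux is proved; v41 not re-lettered (R18.16). AI-written (AI review is weaker than expert review).
[cite: CossartPiltant2019, Thm. 1.1 (i)(ii); Prop. 4.4] [cite: Cesnavicius2021, Thm. 5.3] [cite: Temkin2008, Prop. 2.3.4] [cite: StacksProject, Tag 081T; Tag 080B]
-/

-- single-problem summit: the doubled namespace component is forced
set_option linter.dupNamespace false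

noncomputable section

open CategoryTheory CategoryTheory.Limits AlgebraicGeometry TopologicalSpace IsLocalRing Order
open Literature.AlgebraicGeometry.Resolution

namespace Summit.ResolutionOfSingularities.ResolutionOfSingularities.Theorems.FInjectiveMacaulayfication.StacksFree

open Summit.ResolutionOfSingularities.ResolutionOfSingularities.Theorems.FInjectiveMacaulayfication
open SliceableCentre ClosedPointLocalResolutionAdm ClosedPointLocalResolutionAdmTr ClosedPointLocalResolutionAdmTrMono TrOfResolution TrOfResolutionFull ResolutionOfTr TrFull TrFullStep FTemkinClosedPoints
open DimSlice DimSliceCM DimSliceOfCesnavicius DimSliceTrOne TrFullStepDoor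

/-! ## §1 Twins of the slice engine -/

/-- [flattening-free twin; original docstring:] **Integral form, dimension ≤ d**: a proper birational integral model FULL at every point (dimension ≤ 3: Cossart–Piltant outright; dimension
`n ∈ [4, d]`: §2 with the rungs `4 … n − 1` and the F-half at level `n`). [OURS · conditional-result]
[cite: CossartPiltant2019, Thm. 1.1; Prop. 4.4] [cite: Temkin2008, Prop. 2.3.4] [cite: Cesnavicius2021, Thm. 5.3] -/
theorem fiModel_integral_dimLe_of_cm_of_rungs_of_FF (d : ℕ)
    (hG : CossartPiltant2019General.{0}) (hP : CossartPiltant2019Principalization.{0})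
    (hCM : ∀ (p : ℕ), p.Prime → ∀ {k : Type} [Field k] [CharP k p] {X : Scheme.{0}} (f : X ⟶ Spec (.of k))
      [LocallyOfFiniteType f] [IsIntegral X] (x : X), ringKrullDim (X.presheaf.stalk x) ≠ 0 →
      ∀ (S' : Scheme.{0}) (g : S' ⟶ Spec (X.presheaf.stalk x)) (I : (Spec (X.presheaf.stalk x)).IdealSheafData),
        I ≠ ⊥ → IsBlowup g I → (∀ s : S', g.base s ≠ closedPoint (X.presheaf.stalk x) → s ∈ Scheme.regularLocus S') →
        ∃ 𝓚 : S'.IdealSheafData, 𝓚 ≠ ⊥ ∧ (∀ s ∈ (𝓚.support : Set S'), g.base s = closedPoint (X.presheaf.stalk x)) ∧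
          ∀ (S'' : Scheme.{0}) (π : S'' ⟶ S'), IsBlowup π 𝓚 → ∀ s : S'', IsDomain (S''.presheaf.stalk s) ∧ CMCl (S''.presheaf.stalk s))
    (p : ℕ) [hp : Fact p.Prime]
    (hR : ∀ e r : ℕ, 4 ≤ e → e + 1 ≤ d → 1 ≤ r → ClosedPointLocalResolutionAdmTr p e r)
    (hF : ∀ n : ℕ, 4 ≤ n → n ≤ d → ∀ (k : Type) [Field k] [CharP k p]
    (X : Scheme.{0}) (f : X ⟶ Spec (.of k)),
      IsSeparated f → LocallyOfFiniteType f → QuasiCompact f → IsIntegral X →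
      ∀ x : X, IsClosed ({x} : Set X) → x ∉ Scheme.regularLocus X → ringKrullDim (X.presheaf.stalk x) = n →
      ∀ (S' : Scheme.{0}) (g : S' ⟶ Spec (X.presheaf.stalk x)) (I : (Spec (X.presheaf.stalk x)).IdealSheafData),
        I ≠ ⊥ → (I.support : Set (Spec (X.presheaf.stalk x))) ⊆ (Scheme.regularLocus (Spec (X.presheaf.stalk x)))ᶜ → IsBlowup g I →
        (∀ s : S', g.base s ≠ closedPoint (X.presheaf.stalk x) → s ∈ Scheme.regularLocus S') →
        (∀ s : S', CMCl (S'.presheaf.stalk s)) →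
        ∃ 𝓚 : S'.IdealSheafData, 𝓚 ≠ ⊥ ∧ (∀ s ∈ (𝓚.support : Set S'), g.base s = closedPoint (X.presheaf.stalk x)) ∧
          ∀ (S'' : Scheme.{0}) (π : S'' ⟶ S'), IsBlowup π 𝓚 →
            ∀ s : S'', FullCl p (S''.presheaf.stalk s))
    (k : Type) [Field k] [CharP k p] (X : Scheme.{0}) (f : X ⟶ Spec (.of k))
    [IsSeparated f] [LocallyOfFiniteType f] [QuasiCompact f] [IsIntegral X] (hXd : topologicalKrullDim X ≤ d) :
    ∃ (X' : Scheme.{0}) (π : X' ⟶ X), IsProper π ∧ IsBirational π ∧ IsIntegral X' ∧ ∀ x : X', FullCl p (X'.presheaf.stalk x) := by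
  by_cases h3 : topologicalKrullDim X ≤ 3
  · exact FInjectiveMacaulayficationDimFour.fiModel_integral_of_dim_le_three hG p k X f h3
  · -- `dim X = n` with `4 ≤ n ≤ d`
    obtain ⟨n, h4n, hnd, hn⟩ : ∃ n : ℕ, 4 ≤ n ∧ n ≤ d ∧ topologicalKrullDim X = n := by
      have h := hXd
      induction hD : topologicalKrullDim X using WithBot.recBotCoe with
      | bot => rw [hD] at h3; exact absurd bot_le h3
      | coe a =>
        rw [hD] at h h3
        induction a using ENat.recTopCoe with
        | top => exact absurd (WithBot.coe_le_coe.mp h) (by simp)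
        | coe m =>
          have hm : m ≤ d := by exact_mod_cast (WithBot.coe_le_coe.mp h)
          have hm' : ¬ m ≤ 3 := fun hle =>
            h3 (WithBot.coe_le_coe.mpr (by exact_mod_cast hle : (m : ℕ∞) ≤ (3 : ℕ∞)))
          exact ⟨m, by omega, hm, rfl⟩
    haveI : IsLocallyNoetherian X := LocallyOfFiniteType.isLocallyNoetherian f
    obtain ⟨X'', f'', J'', hf'', hJ'', -, hfull⟩ := exists_isBlowup_full_of_cm_of_rungs_of_FF hG hP hCM h4n p hp.out
      (fun e r he hen hr => hR e r he (by omega) hr) (hF n h4n hnd) k X f hn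
    haveI : IsIntegral X'' := hf''.isIntegral hJ''
    exact ⟨X'', f'', hf''.isProper, hf''.isBirational' hJ'', inferInstance, hfull⟩


/-- [flattening-free twin; original docstring:] **The crux's conclusion for a given reduced `X` of dimension ≤ d** (component gluing as in `DimLe4Reduced`). [OURS · conditional-result]
[cite: CossartPiltant2019, Thm. 1.1; Prop. 4.4; proof of Prop. 4.6 Step 1] [cite: Cesnavicius2021, Thm. 5.3] -/
theorem exists_fiModel_dimLe_of_cm_of_rungs_of_FF (d : ℕ)
    (hG : CossartPiltant2019General.{0}) (hP : CossartPiltant2019Principalization.{0})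
    (hCM : ∀ (p : ℕ), p.Prime → ∀ {k : Type} [Field k] [CharP k p] {X : Scheme.{0}} (f : X ⟶ Spec (.of k))
      [LocallyOfFiniteType f] [IsIntegral X] (x : X), ringKrullDim (X.presheaf.stalk x) ≠ 0 →
      ∀ (S' : Scheme.{0}) (g : S' ⟶ Spec (X.presheaf.stalk x)) (I : (Spec (X.presheaf.stalk x)).IdealSheafData),
        I ≠ ⊥ → IsBlowup g I → (∀ s : S', g.base s ≠ closedPoint (X.presheaf.stalk x) → s ∈ Scheme.regularLocus S') →
        ∃ 𝓚 : S'.IdealSheafData, 𝓚 ≠ ⊥ ∧ (∀ s ∈ (𝓚.support : Set S'), g.base s = closedPoint (X.presheaf.stalk x)) ∧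
          ∀ (S'' : Scheme.{0}) (π : S'' ⟶ S'), IsBlowup π 𝓚 → ∀ s : S'', IsDomain (S''.presheaf.stalk s) ∧ CMCl (S''.presheaf.stalk s))
    (p : ℕ) [Fact p.Prime]
    (hR : ∀ e r : ℕ, 4 ≤ e → e + 1 ≤ d → 1 ≤ r → ClosedPointLocalResolutionAdmTr p e r)
    (hF : ∀ n : ℕ, 4 ≤ n → n ≤ d → ∀ (k : Type) [Field k] [CharP k p]
    (X : Scheme.{0}) (f : X ⟶ Spec (.of k)),
      IsSeparated f → LocallyOfFiniteType f → QuasiCompact f → IsIntegral X →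
      ∀ x : X, IsClosed ({x} : Set X) → x ∉ Scheme.regularLocus X → ringKrullDim (X.presheaf.stalk x) = n →
      ∀ (S' : Scheme.{0}) (g : S' ⟶ Spec (X.presheaf.stalk x)) (I : (Spec (X.presheaf.stalk x)).IdealSheafData),
        I ≠ ⊥ → (I.support : Set (Spec (X.presheaf.stalk x))) ⊆ (Scheme.regularLocus (Spec (X.presheaf.stalk x)))ᶜ → IsBlowup g I →
        (∀ s : S', g.base s ≠ closedPoint (X.presheaf.stalk x) → s ∈ Scheme.regularLocus S') →
        (∀ s : S', CMCl (S'.presheaf.stalk s)) →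
        ∃ 𝓚 : S'.IdealSheafData, 𝓚 ≠ ⊥ ∧ (∀ s ∈ (𝓚.support : Set S'), g.base s = closedPoint (X.presheaf.stalk x)) ∧
          ∀ (S'' : Scheme.{0}) (π : S'' ⟶ S'), IsBlowup π 𝓚 →
            ∀ s : S'', FullCl p (S''.presheaf.stalk s))
    (k : Type) [Field k] [CharP k p] (X : Scheme.{0}) (f : X ⟶ Spec (.of k))
    [IsSeparated f] [LocallyOfFiniteType f] [QuasiCompact f] [IsReduced X] (hXd : topologicalKrullDim X ≤ d) :
    ∃ (X' : Scheme.{0}) (π : X' ⟶ X), IsProper π ∧ IsBirational π ∧ ∀ x : X',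
      IsDomain (X'.presheaf.stalk x) ∧ ∀ d : ℕ, ringKrullDim (X'.presheaf.stalk x) = d →
        ∀ s : Fin d → X'.presheaf.stalk x, (Ideal.span (Set.range s)).radical.IsMaximal →
          RingTheory.Sequence.IsWeaklyRegular (X'.presheaf.stalk x) (List.ofFn s) ∧
          ∀ y : X'.presheaf.stalk x, (∃ e : ℕ, y ^ p ^ e ∈ Ideal.span
            ((fun z : X'.presheaf.stalk x => z ^ p ^ e) ''
              (Ideal.span (Set.range s) : Set (X'.presheaf.stalk x)))) →
            y ∈ Ideal.span (Set.range s) := by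
  refine exists_model_of_forall_closeds
    (fun Y : Scheme.{0} => ∀ y : Y, IsDomain (Y.presheaf.stalk y) ∧
      ∀ d : ℕ, ringKrullDim (Y.presheaf.stalk y) = d →
        ∀ s : Fin d → Y.presheaf.stalk y, (Ideal.span (Set.range s)).radical.IsMaximal →
          RingTheory.Sequence.IsWeaklyRegular (Y.presheaf.stalk y) (List.ofFn s) ∧
          ∀ w : Y.presheaf.stalk y, (∃ e : ℕ, w ^ p ^ e ∈ Ideal.span
            ((fun z : Y.presheaf.stalk y => z ^ p ^ e) ''
              (Ideal.span (Set.range s) : Set (Y.presheaf.stalk y)))) →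
            w ∈ Ideal.span (Set.range s))
    (fun Y hY y => (hY.false y).elim) (fun U V hU hV => fiClause_coprod p hU hV) X f fun Z hZ => ?_
  haveI := hZ
  have hdimZ : topologicalKrullDim (Scheme.IdealSheafData.vanishingIdeal Z).subscheme ≤ d :=
    (DimLe4Reduced.topologicalKrullDim_subscheme_vanishingIdeal_le Z).trans hXd
  obtain ⟨X', π, hprop, hbir, -, hfi⟩ :=
    fiModel_integral_dimLe_of_cm_of_rungs_of_FF d hG hP hCM p hR hF k _ ((Scheme.IdealSheafData.vanishingIdeal Z).subschemeι ≫ f) hdimZ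
  exact ⟨X', π, hprop, hbir, hfi⟩


/-- [flattening-free twin; original docstring:] **★ THE DIM ≤ d SLICE OF THE CRUX ⟸ {CP 1.1, R–G 081R, CP 4.4, Česnavičius 5.3 (as typed)} ∧ RUNGS `4 … d − 1` ∧ F-HALF `4 … d`.** The ∀-text of
`Theses.FrobeniusLadder.FInjectiveMacaulayfication` VERBATIM with the single extra binder `topologicalKrullDim X ≤ d`; the resolution rung
`ClosedPointLocalResolutionAdmTr p e r` enters ONLY at the levels `4 ≤ e ≤ d − 1`, `r ≥ 1` (closed points over `k(X₁,…,X_r)`, imperfect) and the F-half ONLY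
at the levels `4 ≤ n ≤ d` — the per-dimension price tag.
[OURS · conditional-result] [cite: CossartPiltant2019, Thm. 1.1; Prop. 4.4] [cite: Temkin2008, Prop. 2.3.4] [cite: Cesnavicius2021, Thm. 5.3] -/
theorem fInjectiveMacaulayfication_dimLe_of_cm_of_rungs_of_FF (d : ℕ)
    (hG : CossartPiltant2019General.{0}) (hP : CossartPiltant2019Principalization.{0})
    (hCM : ∀ (p : ℕ), p.Prime → ∀ {k : Type} [Field k] [CharP k p] {X : Scheme.{0}} (f : X ⟶ Spec (.of k))
      [LocallyOfFiniteType f] [IsIntegral X] (x : X), ringKrullDim (X.presheaf.stalk x) ≠ 0 →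
      ∀ (S' : Scheme.{0}) (g : S' ⟶ Spec (X.presheaf.stalk x)) (I : (Spec (X.presheaf.stalk x)).IdealSheafData),
        I ≠ ⊥ → IsBlowup g I → (∀ s : S', g.base s ≠ closedPoint (X.presheaf.stalk x) → s ∈ Scheme.regularLocus S') →
        ∃ 𝓚 : S'.IdealSheafData, 𝓚 ≠ ⊥ ∧ (∀ s ∈ (𝓚.support : Set S'), g.base s = closedPoint (X.presheaf.stalk x)) ∧
          ∀ (S'' : Scheme.{0}) (π : S'' ⟶ S'), IsBlowup π 𝓚 → ∀ s : S'', IsDomain (S''.presheaf.stalk s) ∧ CMCl (S''.presheaf.stalk s))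
    (hR : ∀ p e r : ℕ, p.Prime → 4 ≤ e → e + 1 ≤ d → 1 ≤ r → ClosedPointLocalResolutionAdmTr p e r)
    (hF : ∀ n : ℕ, 4 ≤ n → n ≤ d → ∀ (p : ℕ), p.Prime → ∀ (k : Type) [Field k] [CharP k p]
    (X : Scheme.{0}) (f : X ⟶ Spec (.of k)),
      IsSeparated f → LocallyOfFiniteType f → QuasiCompact f → IsIntegral X →
      ∀ x : X, IsClosed ({x} : Set X) → x ∉ Scheme.regularLocus X → ringKrullDim (X.presheaf.stalk x) = n →
      ∀ (S' : Scheme.{0}) (g : S' ⟶ Spec (X.presheaf.stalk x)) (I : (Spec (X.presheaf.stalk x)).IdealSheafData),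
        I ≠ ⊥ → (I.support : Set (Spec (X.presheaf.stalk x))) ⊆ (Scheme.regularLocus (Spec (X.presheaf.stalk x)))ᶜ → IsBlowup g I →
        (∀ s : S', g.base s ≠ closedPoint (X.presheaf.stalk x) → s ∈ Scheme.regularLocus S') →
        (∀ s : S', CMCl (S'.presheaf.stalk s)) →
        ∃ 𝓚 : S'.IdealSheafData, 𝓚 ≠ ⊥ ∧ (∀ s ∈ (𝓚.support : Set S'), g.base s = closedPoint (X.presheaf.stalk x)) ∧
          ∀ (S'' : Scheme.{0}) (π : S'' ⟶ S'), IsBlowup π 𝓚 →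
            ∀ s : S'', FullCl p (S''.presheaf.stalk s)) :
    ∀ p : ℕ, p.Prime → ∀ (k : Type) [Field k] [CharP k p] (X : Scheme.{0}) (f : X ⟶ Spec (.of k)),
      IsSeparated f → LocallyOfFiniteType f → QuasiCompact f → IsReduced X → topologicalKrullDim X ≤ d →
      ∃ (X' : Scheme.{0}) (π : X' ⟶ X), IsProper π ∧ IsBirational π ∧ ∀ x : X',
        IsDomain (X'.presheaf.stalk x) ∧ ∀ d : ℕ, ringKrullDim (X'.presheaf.stalk x) = d →
          ∀ s : Fin d → X'.presheaf.stalk x, (Ideal.span (Set.range s)).radical.IsMaximal →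
            RingTheory.Sequence.IsWeaklyRegular (X'.presheaf.stalk x) (List.ofFn s) ∧
            ∀ y : X'.presheaf.stalk x, (∃ e : ℕ, y ^ p ^ e ∈ Ideal.span
              ((fun z : X'.presheaf.stalk x => z ^ p ^ e) ''
                (Ideal.span (Set.range s) : Set (X'.presheaf.stalk x)))) →
              y ∈ Ideal.span (Set.range s) := by
  intro p hp k _ _ X f hsep hft hqc hred hXd
  haveI : Fact p.Prime := ⟨hp⟩
  haveI := hsep
  haveI := hft
  haveI := hqc
  haveI := hred
  exact exists_fiModel_dimLe_of_cm_of_rungs_of_FF d hG hP hCM p (fun e r he hed hr => hR p e r hp he hed hr)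
    (fun n hn hnd => hF n hn hnd p hp) k X f hXd


/-- [flattening-free twin; original docstring:] ★ **THE DIM ≤ d SLICE BY NAME (reading (B), door v37's named fact)**: on schemes of dimension `≤ d` the crux ⟸ {CP 1.1, 081R, CP 4.4, Česnavičius 5.3} ∧
the transcendental-field rungs at levels `4 … d − 1` ∧ the F-half at levels `4 … d`. [OURS · conditional-result] [cite: Cesnavicius2021, Thm. 5.3]
[cite: CossartPiltant2019, Thm. 1.1; Prop. 4.4] [cite: Temkin2008, Prop. 2.3.4] -/
theorem fInjectiveMacaulayfication_dimLe_of_cesnaviciusOffClosed_of_rungs_of_FF (d : ℕ)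
    (hG : CossartPiltant2019General.{0}) (hP : CossartPiltant2019Principalization.{0})
    (hM : CesnaviciusBlowupMacaulayficationOffClosed.{0})
    (hR : ∀ p e r : ℕ, p.Prime → 4 ≤ e → e + 1 ≤ d → 1 ≤ r → ClosedPointLocalResolutionAdmTr p e r)
    (hF : ∀ n : ℕ, 4 ≤ n → n ≤ d → ∀ (p : ℕ), p.Prime → ∀ (k : Type) [Field k] [CharP k p]
    (X : Scheme.{0}) (f : X ⟶ Spec (.of k)),
      IsSeparated f → LocallyOfFiniteType f → QuasiCompact f → IsIntegral X →
      ∀ x : X, IsClosed ({x} : Set X) → x ∉ Scheme.regularLocus X → ringKrullDim (X.presheaf.stalk x) = n →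
      ∀ (S' : Scheme.{0}) (g : S' ⟶ Spec (X.presheaf.stalk x)) (I : (Spec (X.presheaf.stalk x)).IdealSheafData),
        I ≠ ⊥ → (I.support : Set (Spec (X.presheaf.stalk x))) ⊆ (Scheme.regularLocus (Spec (X.presheaf.stalk x)))ᶜ → IsBlowup g I →
        (∀ s : S', g.base s ≠ closedPoint (X.presheaf.stalk x) → s ∈ Scheme.regularLocus S') →
        (∀ s : S', CMCl (S'.presheaf.stalk s)) →
        ∃ 𝓚 : S'.IdealSheafData, 𝓚 ≠ ⊥ ∧ (∀ s ∈ (𝓚.support : Set S'), g.base s = closedPoint (X.presheaf.stalk x)) ∧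
          ∀ (S'' : Scheme.{0}) (π : S'' ⟶ S'), IsBlowup π 𝓚 →
            ∀ s : S'', FullCl p (S''.presheaf.stalk s)) :
    ∀ p : ℕ, p.Prime → ∀ (k : Type) [Field k] [CharP k p] (X : Scheme.{0}) (f : X ⟶ Spec (.of k)),
      IsSeparated f → LocallyOfFiniteType f → QuasiCompact f → IsReduced X → topologicalKrullDim X ≤ d →
      ∃ (X' : Scheme.{0}) (π : X' ⟶ X), IsProper π ∧ IsBirational π ∧ ∀ x : X',
        IsDomain (X'.presheaf.stalk x) ∧ ∀ d : ℕ, ringKrullDim (X'.presheaf.stalk x) = d →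
          ∀ s : Fin d → X'.presheaf.stalk x, (Ideal.span (Set.range s)).radical.IsMaximal →
            RingTheory.Sequence.IsWeaklyRegular (X'.presheaf.stalk x) (List.ofFn s) ∧
            ∀ y : X'.presheaf.stalk x, (∃ e : ℕ, y ^ p ^ e ∈ Ideal.span
              ((fun z : X'.presheaf.stalk x => z ^ p ^ e) ''
                (Ideal.span (Set.range s) : Set (X'.presheaf.stalk x)))) →
              y ∈ Ideal.span (Set.range s) :=
  fInjectiveMacaulayfication_dimLe_of_cm_of_rungs_of_FF d hG hP (cmSupplier_of_cesnaviciusOffClosed hM) hR hF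


/-- [flattening-free twin; original docstring:] ★★ **THE DIM ≤ 4 SLICE BY NAME: on schemes of dimension `≤ 4` the crux ⟸ FOUR PUBLISHED THEOREMS {CP 2019 Thm 1.1, R–G 081R, CP 2019 Prop 4.4,
Česnavičius 2021 Thm 5.3} ∧ THE F-HALF AT LEVEL 4 — NO resolution residue.** [OURS · conditional-result: conditional on the CANDIDATE F-half at level 4]
[cite: Cesnavicius2021, Thm. 5.3] [cite: CossartPiltant2019, Thm. 1.1 (i)(ii); Prop. 4.4] [cite: RaynaudGruson1971, Thm. 5.2.2] [cite: Temkin2008, Prop. 2.3.4] -/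
theorem fInjectiveMacaulayfication_dimLe4_of_cesnaviciusOffClosed_of_F4F
    (hG : CossartPiltant2019General.{0}) (hP : CossartPiltant2019Principalization.{0})
    (hM : CesnaviciusBlowupMacaulayficationOffClosed.{0})
    (hF4 : ∀ (p : ℕ), p.Prime → ∀ (k : Type) [Field k] [CharP k p]
    (X : Scheme.{0}) (f : X ⟶ Spec (.of k)),
      IsSeparated f → LocallyOfFiniteType f → QuasiCompact f → IsIntegral X →
      ∀ x : X, IsClosed ({x} : Set X) → x ∉ Scheme.regularLocus X → ringKrullDim (X.presheaf.stalk x) = 4 →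
      ∀ (S' : Scheme.{0}) (g : S' ⟶ Spec (X.presheaf.stalk x)) (I : (Spec (X.presheaf.stalk x)).IdealSheafData),
        I ≠ ⊥ → (I.support : Set (Spec (X.presheaf.stalk x))) ⊆ (Scheme.regularLocus (Spec (X.presheaf.stalk x)))ᶜ → IsBlowup g I →
        (∀ s : S', g.base s ≠ closedPoint (X.presheaf.stalk x) → s ∈ Scheme.regularLocus S') →
        (∀ s : S', CMCl (S'.presheaf.stalk s)) →
        ∃ 𝓚 : S'.IdealSheafData, 𝓚 ≠ ⊥ ∧ (∀ s ∈ (𝓚.support : Set S'), g.base s = closedPoint (X.presheaf.stalk x)) ∧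
          ∀ (S'' : Scheme.{0}) (π : S'' ⟶ S'), IsBlowup π 𝓚 →
            ∀ s : S'', FullCl p (S''.presheaf.stalk s)) :
    ∀ p : ℕ, p.Prime → ∀ (k : Type) [Field k] [CharP k p] (X : Scheme.{0}) (f : X ⟶ Spec (.of k)),
      IsSeparated f → LocallyOfFiniteType f → QuasiCompact f → IsReduced X → topologicalKrullDim X ≤ 4 →
      ∃ (X' : Scheme.{0}) (π : X' ⟶ X), IsProper π ∧ IsBirational π ∧ ∀ x : X',
        IsDomain (X'.presheaf.stalk x) ∧ ∀ d : ℕ, ringKrullDim (X'.presheaf.stalk x) = d →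
          ∀ s : Fin d → X'.presheaf.stalk x, (Ideal.span (Set.range s)).radical.IsMaximal →
            RingTheory.Sequence.IsWeaklyRegular (X'.presheaf.stalk x) (List.ofFn s) ∧
            ∀ y : X'.presheaf.stalk x, (∃ e : ℕ, y ^ p ^ e ∈ Ideal.span
              ((fun z : X'.presheaf.stalk x => z ^ p ^ e) ''
                (Ideal.span (Set.range s) : Set (X'.presheaf.stalk x)))) →
              y ∈ Ideal.span (Set.range s) := by
  refine fInjectiveMacaulayfication_dimLe_of_cesnaviciusOffClosed_of_rungs_of_FF 4 hG hP hM (fun p e r _ he hed _ => by omega) ?_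
  intro n hn hn4
  obtain rfl : n = 4 := le_antisymm hn4 hn
  exact hF4


/-! ## §2 ★★ dim ≤ 4 on TWO prints -/

/-- ★★ **ON SCHEMES OF DIMENSION ≤ 4: crux ⟸ Cossart–Piltant 2019 Thm 1.1 ∧ Česnavičius 2021 Thm 5.3-(B) ∧ F(4)** — CP 2019 Prop 4.4 is the tree theorem
`CP2008Prop44.CossartPiltant2019Principalization_holds`, Raynaud–Gruson flattening is no longer an input; the F-half at level 4 is the ONLY research hypothesis. [OURS · conditional-result] -/
theorem fInjectiveMacaulayfication_dimLe4_of_twoPrints_of_F4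
    (hG : CossartPiltant2019General.{0}) (hM : CesnaviciusBlowupMacaulayficationOffClosed.{0})
    (hF4 : ∀ (p : ℕ), p.Prime → ∀ (k : Type) [Field k] [CharP k p]
    (X : Scheme.{0}) (f : X ⟶ Spec (.of k)),
      IsSeparated f → LocallyOfFiniteType f → QuasiCompact f → IsIntegral X →
      ∀ x : X, IsClosed ({x} : Set X) → x ∉ Scheme.regularLocus X → ringKrullDim (X.presheaf.stalk x) = 4 →
      ∀ (S' : Scheme.{0}) (g : S' ⟶ Spec (X.presheaf.stalk x)) (I : (Spec (X.presheaf.stalk x)).IdealSheafData),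
        I ≠ ⊥ → (I.support : Set (Spec (X.presheaf.stalk x))) ⊆ (Scheme.regularLocus (Spec (X.presheaf.stalk x)))ᶜ → IsBlowup g I →
        (∀ s : S', g.base s ≠ closedPoint (X.presheaf.stalk x) → s ∈ Scheme.regularLocus S') →
        (∀ s : S', CMCl (S'.presheaf.stalk s)) →
        ∃ 𝓚 : S'.IdealSheafData, 𝓚 ≠ ⊥ ∧ (∀ s ∈ (𝓚.support : Set S'), g.base s = closedPoint (X.presheaf.stalk x)) ∧
          ∀ (S'' : Scheme.{0}) (π : S'' ⟶ S'), IsBlowup π 𝓚 →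
            ∀ s : S'', FullCl p (S''.presheaf.stalk s)) :
    ∀ p : ℕ, p.Prime → ∀ (k : Type) [Field k] [CharP k p] (X : Scheme.{0}) (f : X ⟶ Spec (.of k)),
      IsSeparated f → LocallyOfFiniteType f → QuasiCompact f → IsReduced X → topologicalKrullDim X ≤ 4 →
      ∃ (X' : Scheme.{0}) (π : X' ⟶ X), IsProper π ∧ IsBirational π ∧ ∀ x : X',
        IsDomain (X'.presheaf.stalk x) ∧ ∀ d : ℕ, ringKrullDim (X'.presheaf.stalk x) = d →
          ∀ s : Fin d → X'.presheaf.stalk x, (Ideal.span (Set.range s)).radical.IsMaximal →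
            RingTheory.Sequence.IsWeaklyRegular (X'.presheaf.stalk x) (List.ofFn s) ∧
            ∀ y : X'.presheaf.stalk x, (∃ e : ℕ, y ^ p ^ e ∈ Ideal.span
              ((fun z : X'.presheaf.stalk x => z ^ p ^ e) ''
                (Ideal.span (Set.range s) : Set (X'.presheaf.stalk x)))) →
              y ∈ Ideal.span (Set.range s) :=
  fInjectiveMacaulayfication_dimLe4_of_cesnaviciusOffClosed_of_F4F hG Summit.ResolutionOfSingularities.ResolutionOfSingularities.Theorems.CP2008Prop44.CossartPiltant2019Principalization_holds.{0} hM hF4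

end Summit.ResolutionOfSingularities.ResolutionOfSingularities.Theorems.FInjectiveMacaulayfication.StacksFree

end
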